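import Mathlib
import Summits.NavierStokesRegularity.NavierStokesRegularity.Theorems.EulerZoomLiouvillePowerGaugeEulerLiouvilleBirthDefs
import Summits.NavierStokesRegularity.NavierStokesRegularity.Theorems.EulerZoomLiouvillePowerGaugeEulerLiouvilleWeakAntiEquivariantMember
import Summits.NavierStokesRegularity.NavierStokesRegularity.Theorems.EulerZoomLiouvillePowerGaugeEulerLiouvilleDistributionallySteady
import Summits.NavierStokesRegularity.NavierStokesRegularity.Theorems.EulerZoomLiouvillePowerGaugeEulerLiouvilleAePastSteady
import HarnessLib

/-!
# Crux `EulerZoomLiouville.PowerGaugeEulerLiouville` (stmt-NavierStokesRegularity-19832), stub `stub_nonSelfSimilarRest`: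
# WRONG-PARITY MEMBERS ARE TRIVIAL — no member of Seregin's class is anti-equivariant under a linear isometry in its far past

Helper file (theorems only; `--supports stmt-NavierStokesRegularity-19832`; def-free).  Hand leafhand-ns-eulerzoomliouville-10 g3; assembles
`…WeakAntiEquivariantMember` (a `±` pair is steady in `𝒟'`), `…DistributionallySteady` (steady in `𝒟'` ⇒ a.e. steady) and `…AePastSteady`
(a.e.-steady past ⇒ trivial).  This is the NON-self-similar, regularity-free twin of hand g2's `Birth.selfSimilar_of_antiEquivariantMember`
(`…WeakAntiEquivariantProfile`), which that hand's exit report recommended as the next helper.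

* `Loc.ae_eq_zero_of_antiEquivariantMember` — MEMBER LEVEL, crux hypotheses verbatim, every `ρ > 0`, no regularity and no ansatz: if
  `u(τ, Rx) = −R u(τ, x)` for all `τ < T₁ ≤ 0` and all `x`, for some linear isometry `R` of `ℝ³`, then `u = 0` a.e. on the slab;
* `Birth.nonSelfSimilar_of_antiEquivariantMember` — the same in the skeleton's binder language (`Birth.InClass`), a closed sub-stratum of
  `stub_nonSelfSimilarRest` (and of both self-similar stubs); instances `Birth.nonSelfSimilar_of_evenMember` (`R = −1`: velocity EVEN in `x`
  in the far past — «profiles/members come in no `±` pairs»), reflections in a plane and half-turns about an axis through the origin (the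
  wrong-parity mirror / axial symmetries; the RIGHT parity `u(τ,Rx) = +R u(τ,x)` is the open axisymmetric / mirror-symmetric world).

WHAT THIS IS NOT: not a proof of the stub or of the crux (the generic member has no such symmetry); nothing about Navier–Stokes.
[folklore; MajdaBertozziCUP2002 §1.2 Prop. 1.1 (symmetry group of Euler)]
-/

noncomputable section

-- flat `Theorems/<Route><Decl>…` files of one crux share the namespace of the crux (tree convention)
set_option linter.dupNamespace false

open MeasureTheory Set Filter Topology Metric Function TopologicalSpace
open scoped RealInnerProductSpace NNReal ENNReal ContDiff

namespace Summit.NavierStokesRegularity.NavierStokesRegularity.Theorems.PowerGaugeEulerLiouville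

open Literature.Analysis Literature.Analysis.FunctionSpaces Literature.Analysis.FluidPDE

/-- **WRONG-PARITY MEMBERS ARE TRIVIAL (member level, every `ρ > 0`, no regularity, no ansatz).**  Let `(u, p)` be a suitable weak Euler pair on
`(−∞,0) × ℝ³` with weak spatial gradient `H` and gauges `a^{2ρ} A(a) + a^{ρ} E(a) + a^{2ρ} D(a) ≤ c`, and suppose `u(τ, Rx) = −R u(τ, x)` for all
`τ < T₁ ≤ 0`, all `x`, for some linear isometry `R` of `ℝ³`.  Then `u = 0` a.e. on the slab: the velocity is distributionally steady on the past slab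
(`AntiMember.integral_deriv_mul_inner_eq_zero_of_antiEquivariant`), hence a.e. equal to one slice there (`DistSteady.exists_ae_eq_slice`; the
slices are locally integrable by `FrameSteady.ae_hasWeakFDerivOn_slice_past`), hence trivial (`AePastSteady.ae_eq_zero_of_gauge_of_aePastSteady`).
[folklore; MajdaBertozziCUP2002 §1.2 Prop. 1.1] -/
theorem Loc.ae_eq_zero_of_antiEquivariantMember {ρ : ℝ} (hρ : 0 < ρ)
    {u : ℝ → EuclideanSpace ℝ (Fin 3) → EuclideanSpace ℝ (Fin 3)} {p : ℝ → EuclideanSpace ℝ (Fin 3) → ℝ}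
    {H : ℝ → EuclideanSpace ℝ (Fin 3) → EuclideanSpace ℝ (Fin 3) →L[ℝ] EuclideanSpace ℝ (Fin 3)} {c : ℝ≥0}
    (hsw : IsSuitableWeakSolutionOn (slab (EuclideanSpace ℝ (Fin 3)) (Iio 0) isOpen_Iio) 0 0 u p)
    (hH : HasWeakSpatialGradientOn (slab (EuclideanSpace ℝ (Fin 3)) (Iio 0) isOpen_Iio) u H)
    (hgauge : ∀ a : ℝ, 0 < a →
      ENNReal.ofReal (a ^ (2 * ρ)) * cknA a (0 : ℝ × EuclideanSpace ℝ (Fin 3)) u +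
          ENNReal.ofReal (a ^ ρ) * cknE a (0 : ℝ × EuclideanSpace ℝ (Fin 3)) H +
        ENNReal.ofReal (a ^ (2 * ρ)) * cknD a (0 : ℝ × EuclideanSpace ℝ (Fin 3)) p ≤ (c : ℝ≥0∞))
    (R : EuclideanSpace ℝ (Fin 3) ≃ₗᵢ[ℝ] EuclideanSpace ℝ (Fin 3)) {T₁ : ℝ} (hT₁ : T₁ ≤ 0)
    (hanti : ∀ τ : ℝ, τ < T₁ → ∀ x : EuclideanSpace ℝ (Fin 3), u τ (R x) = -(R (u τ x))) :
    uncurry u =ᵐ[volume.restrict (Iio (0 : ℝ) ×ˢ (univ : Set (EuclideanSpace ℝ (Fin 3))))] 0 := by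
  have hA : ∀ a : ℝ, 0 < a → ENNReal.ofReal (a ^ (2 * ρ)) *
      cknA a (0 : ℝ × EuclideanSpace ℝ (Fin 3)) u ≤ (c : ℝ≥0∞) :=
    fun a ha => le_trans (le_trans le_self_add le_self_add) (hgauge a ha)
  -- (1) distributionally steady on the past slab
  have hsteady : ∀ θ : ℝ → ℝ, ContDiff ℝ ∞ θ → HasCompactSupport θ → tsupport θ ⊆ Iio T₁ →
      ∀ Φ : EuclideanSpace ℝ (Fin 3) → EuclideanSpace ℝ (Fin 3), Continuous Φ → HasCompactSupport Φ →
        ∫ z : ℝ × EuclideanSpace ℝ (Fin 3), deriv θ z.1 * ⟪u z.1 z.2, Φ z.2⟫ = 0 :=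
    fun θ hθ hθc hθT Φ hΦ hΦc =>
      AntiMember.integral_deriv_mul_inner_eq_zero_of_antiEquivariant (by linarith) hsw hA R hT₁ hanti hθ hθc hθT hΦ hΦc
  -- (2) a.e. equal to one slice on the past slab
  have hu : LocallyIntegrableOn (uncurry u) (Iio T₁ ×ˢ (univ : Set (EuclideanSpace ℝ (Fin 3)))) volume := by
    have h0 : LocallyIntegrableOn (uncurry u) (Iio (0 : ℝ) ×ˢ (univ : Set (EuclideanSpace ℝ (Fin 3)))) volume := by
      simpa only [coe_slab] using hsw.distributional.1
    exact h0.mono_set (prod_mono (Iio_subset_Iio hT₁) Subset.rfl)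
  have hsl : ∀ᵐ t ∂(volume.restrict (Iio T₁)), LocallyIntegrable (u t) volume := by
    filter_upwards [FrameSteady.ae_hasWeakFDerivOn_slice_past hH hT₁] with t ht
    exact locallyIntegrableOn_univ.1 (by simpa only [Opens.coe_top] using ht.locallyIntegrableOn)
  obtain ⟨t₀, -, -, hU⟩ := DistSteady.exists_ae_eq_slice hu hsl hsteady
  -- (3) a.e.-steady past ⇒ trivial
  exact AePastSteady.ae_eq_zero_of_gauge_of_aePastSteady hρ hsw hH hgauge hT₁ hU

/-- **NO MEMBER IS ANTI-EQUIVARIANT UNDER A LINEAR ISOMETRY IN ITS FAR PAST** (binder language of the skeleton of record, `Birth.InClass`, every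
`ρ > 0`, no regularity, no ansatz): a class member with `u(τ, Rx) = −R u(τ, x)` for all `τ < T₁`, some `T₁ ≤ 0` and some linear isometry `R` of `ℝ³`,
is trivial — a closed sub-stratum of `stub_nonSelfSimilarRest`. [folklore] -/
theorem Birth.nonSelfSimilar_of_antiEquivariantMember :
    ∀ ρ : ℝ, 0 < ρ →
      ∀ (u : ℝ → EuclideanSpace ℝ (Fin 3) → EuclideanSpace ℝ (Fin 3)) (p : ℝ → EuclideanSpace ℝ (Fin 3) → ℝ)
        (H : ℝ → EuclideanSpace ℝ (Fin 3) → EuclideanSpace ℝ (Fin 3) →L[ℝ] EuclideanSpace ℝ (Fin 3)) (c : ℝ≥0),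
        Birth.InClass ρ u p H c →
          (∃ T₁ : ℝ, T₁ ≤ 0 ∧ ∃ R : EuclideanSpace ℝ (Fin 3) ≃ₗᵢ[ℝ] EuclideanSpace ℝ (Fin 3),
              ∀ τ : ℝ, τ < T₁ → ∀ x : EuclideanSpace ℝ (Fin 3), u τ (R x) = -(R (u τ x))) →
          uncurry u =ᵐ[volume.restrict (Iio (0 : ℝ) ×ˢ (univ : Set (EuclideanSpace ℝ (Fin 3))))] 0 := by
  intro ρ hρ u p H c hcl hR
  obtain ⟨T₁, hT₁, R, hanti⟩ := hR
  exact Loc.ae_eq_zero_of_antiEquivariantMember hρ hcl.1 hcl.2.1 hcl.2.2 R hT₁ hanti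

/-- **NO MEMBER IS EVEN IN ITS FAR PAST** (`R = −1`): a class member with `u(τ, −x) = u(τ, x)` for all `τ < T₁`, some `T₁ ≤ 0`, is trivial.
[folklore] -/
theorem Birth.nonSelfSimilar_of_evenMember :
    ∀ ρ : ℝ, 0 < ρ →
      ∀ (u : ℝ → EuclideanSpace ℝ (Fin 3) → EuclideanSpace ℝ (Fin 3)) (p : ℝ → EuclideanSpace ℝ (Fin 3) → ℝ)
        (H : ℝ → EuclideanSpace ℝ (Fin 3) → EuclideanSpace ℝ (Fin 3) →L[ℝ] EuclideanSpace ℝ (Fin 3)) (c : ℝ≥0),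
        Birth.InClass ρ u p H c →
          (∃ T₁ : ℝ, T₁ ≤ 0 ∧ ∀ τ : ℝ, τ < T₁ → ∀ x : EuclideanSpace ℝ (Fin 3), u τ (-x) = u τ x) →
          uncurry u =ᵐ[volume.restrict (Iio (0 : ℝ) ×ˢ (univ : Set (EuclideanSpace ℝ (Fin 3))))] 0 := by
  intro ρ hρ u p H c hcl hE
  obtain ⟨T₁, hT₁, heven⟩ := hE
  refine Birth.nonSelfSimilar_of_antiEquivariantMember ρ hρ u p H c hcl ⟨T₁, hT₁, LinearIsometryEquiv.neg ℝ, fun τ hτ x => ?_⟩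
  simp only [LinearIsometryEquiv.coe_neg, neg_neg]
  exact heven τ hτ x

/-- **The symmetry may equally be imposed on the whole slab** (`T₁ = 0`): a member with `u(τ, Rx) = −R u(τ, x)` for all `τ < 0` is trivial.
[folklore] -/
theorem Birth.nonSelfSimilar_of_antiEquivariantMember_all :
    ∀ ρ : ℝ, 0 < ρ →
      ∀ (u : ℝ → EuclideanSpace ℝ (Fin 3) → EuclideanSpace ℝ (Fin 3)) (p : ℝ → EuclideanSpace ℝ (Fin 3) → ℝ)
        (H : ℝ → EuclideanSpace ℝ (Fin 3) → EuclideanSpace ℝ (Fin 3) →L[ℝ] EuclideanSpace ℝ (Fin 3)) (c : ℝ≥0),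
        Birth.InClass ρ u p H c →
          (∃ R : EuclideanSpace ℝ (Fin 3) ≃ₗᵢ[ℝ] EuclideanSpace ℝ (Fin 3),
              ∀ τ : ℝ, τ < 0 → ∀ x : EuclideanSpace ℝ (Fin 3), u τ (R x) = -(R (u τ x))) →
          uncurry u =ᵐ[volume.restrict (Iio (0 : ℝ) ×ˢ (univ : Set (EuclideanSpace ℝ (Fin 3))))] 0 := by
  intro ρ hρ u p H c hcl hR
  obtain ⟨R, hanti⟩ := hR
  exact Birth.nonSelfSimilar_of_antiEquivariantMember ρ hρ u p H c hcl ⟨0, le_rfl, R, hanti⟩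

/-! ## Appendix (hand g3): the two bridges in binder language -/

/-- **Binder language: A.E.-STEADY PAST ⇒ TRIVIAL** — the a.e. upgrade of `IsPastSteady` (sense 1): `u(τ, x) = U(x)` for a.e.
`(τ, x) ∈ (−∞,T₁) × ℝ³`, some `T₁ ≤ 0`, some `U` (no regularity, no decay) ⇒ `u = 0` a.e. (`AePastSteady.ae_eq_zero_of_gauge_of_aePastSteady`).
[folklore] -/
theorem Birth.nonSelfSimilar_of_aePastSteady :
    ∀ ρ : ℝ, 0 < ρ →
      ∀ (u : ℝ → EuclideanSpace ℝ (Fin 3) → EuclideanSpace ℝ (Fin 3)) (p : ℝ → EuclideanSpace ℝ (Fin 3) → ℝ)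
        (H : ℝ → EuclideanSpace ℝ (Fin 3) → EuclideanSpace ℝ (Fin 3) →L[ℝ] EuclideanSpace ℝ (Fin 3)) (c : ℝ≥0),
        Birth.InClass ρ u p H c →
          (∃ T₁ : ℝ, T₁ ≤ 0 ∧ ∃ U : EuclideanSpace ℝ (Fin 3) → EuclideanSpace ℝ (Fin 3),
              ∀ᵐ z ∂(volume.restrict (Iio T₁ ×ˢ (univ : Set (EuclideanSpace ℝ (Fin 3))))), u z.1 z.2 = U z.2) →
          uncurry u =ᵐ[volume.restrict (Iio (0 : ℝ) ×ˢ (univ : Set (EuclideanSpace ℝ (Fin 3))))] 0 := by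
  intro ρ hρ u p H c hcl h
  obtain ⟨T₁, hT₁, U, hU⟩ := h
  exact AePastSteady.ae_eq_zero_of_gauge_of_aePastSteady hρ hcl.1 hcl.2.1 hcl.2.2 hT₁ hU

/-- **Binder language: DISTRIBUTIONALLY STEADY PAST ⇒ TRIVIAL** — `∂ₜu = 0` in `𝒟'((−∞,T₁) × ℝ³)` in the tensor-tested form
`∫∫ θ'(t) ⟪u(t,x), Φ(x)⟫ = 0` for all `θ ∈ C_c^∞((−∞,T₁))` and all continuous compactly supported `Φ`, some `T₁ ≤ 0` ⇒ `u = 0` a.e.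
(`DistSteady.exists_ae_eq_slice` + `AePastSteady.ae_eq_zero_of_gauge_of_aePastSteady`). [folklore] -/
theorem Birth.nonSelfSimilar_of_distributionallySteadyPast :
    ∀ ρ : ℝ, 0 < ρ →
      ∀ (u : ℝ → EuclideanSpace ℝ (Fin 3) → EuclideanSpace ℝ (Fin 3)) (p : ℝ → EuclideanSpace ℝ (Fin 3) → ℝ)
        (H : ℝ → EuclideanSpace ℝ (Fin 3) → EuclideanSpace ℝ (Fin 3) →L[ℝ] EuclideanSpace ℝ (Fin 3)) (c : ℝ≥0),
        Birth.InClass ρ u p H c →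
          (∃ T₁ : ℝ, T₁ ≤ 0 ∧ ∀ θ : ℝ → ℝ, ContDiff ℝ ∞ θ → HasCompactSupport θ → tsupport θ ⊆ Iio T₁ →
              ∀ Φ : EuclideanSpace ℝ (Fin 3) → EuclideanSpace ℝ (Fin 3), Continuous Φ → HasCompactSupport Φ →
                ∫ z : ℝ × EuclideanSpace ℝ (Fin 3), deriv θ z.1 * ⟪u z.1 z.2, Φ z.2⟫ = 0) →
          uncurry u =ᵐ[volume.restrict (Iio (0 : ℝ) ×ˢ (univ : Set (EuclideanSpace ℝ (Fin 3))))] 0 := by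
  intro ρ hρ u p H c hcl h
  obtain ⟨T₁, hT₁, hsteady⟩ := h
  have hu : LocallyIntegrableOn (uncurry u) (Iio T₁ ×ˢ (univ : Set (EuclideanSpace ℝ (Fin 3)))) volume := by
    have h0 : LocallyIntegrableOn (uncurry u) (Iio (0 : ℝ) ×ˢ (univ : Set (EuclideanSpace ℝ (Fin 3)))) volume := by
      simpa only [coe_slab] using hcl.1.distributional.1
    exact h0.mono_set (prod_mono (Iio_subset_Iio hT₁) Subset.rfl)
  have hsl : ∀ᵐ t ∂(volume.restrict (Iio T₁)), LocallyIntegrable (u t) volume := by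
    filter_upwards [FrameSteady.ae_hasWeakFDerivOn_slice_past hcl.2.1 hT₁] with t ht
    exact locallyIntegrableOn_univ.1 (by simpa only [Opens.coe_top] using ht.locallyIntegrableOn)
  obtain ⟨t₀, -, -, hU⟩ := DistSteady.exists_ae_eq_slice hu hsl hsteady
  exact AePastSteady.ae_eq_zero_of_gauge_of_aePastSteady hρ hcl.1 hcl.2.1 hcl.2.2 hT₁ hU

end Summit.NavierStokesRegularity.NavierStokesRegularity.Theorems.PowerGaugeEulerLiouville

end
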